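import Summits.Ventures.HodgeRepro2.T6Main
import Summits.Ventures.HodgeRepro2.T6A2WeilAssembly
import Summits.Ventures.HodgeRepro2.T6A1HostBridge
import Summits.Ventures.HodgeRepro2.T6HostCoeffNatural

/-!
# T6MainM1 — the M1 (host) body: `HostAPI.HCCM.Statement` from the displays and ONE (N) binder (README §10.4 M1)

Cell pub-hodge-repro2, Tier 6 (README §10), seat t6-lead (gen 6). The final theorem of record is STATED in
T6Main (`HCCMOfPublished`, the M0 form, untouched here — this module IMPORTS it so the M0 hash-frozen set stays
as declared). M1 (README §10.4): «the conclusion of Theorem A derived MODULO a single displayed hypothesis (N)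
plus the displayed published theorems». The body is the (S4) carrier `Hyp.Given_S4` applied to `Hyp.HodgeModelExists`
and to the host composite on every corner product — t6-p2's `WeilAssembly.splitWeilAlgebraic_of_A2`
(T6A2WeilAssembly: the transfer shadow `shadowOf` and its `halg` built from host data and the displays alone, on the
lead's `Host.splitWeilAlgebraic_of_displays`) — with every display consumed BY NAME and nothing else assumed:
* `h0 : Hyp.HodgeModelExists`, `hS4 : Hyp.Given_S4` (T6HypHost; the M0 pair);
* `hBd : Hyp.BettiHodge coeffC₀` (T6HostBetti; the Betti datum with its clauses, `coeffC₀` the change of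
  coefficients `ℂ ⊗[ℚ] H^k(X(ℂ), ℚ) → H^k(X(ℂ), ℂ)` of T6HostCoeff, natural by t6-p2's THEOREM `coeffNatural`);
* `h17 : Hyp.LangeBirkenhake1992_Lemma1_1_17` (through t6-p1's `A1HostBridge.lemma1117Q_of_display`, definitional);
* `hD : ∀ Bd, Hyp.LangeBirkenhake1992_Prop1_1_20 Bd`, `hLefD : ∀ Bd, Hyp.Lefschetz11_Betti Bd`,
  `hT21 : ∀ Bd, Hyp.LangeBirkenhake1992_Thm1_1_21_Betti Bd` (t6-p2's displays on the Weil carrier `Bd.W`);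
* `hProd : Hyp.Hartshorne1977_productProjective`, `hPt : Hyp.Hartshorne1977_pointProjective` (T6A2HypHost);
* **the ONE (N) binder** `hN : Hyp.PeriodNHost …` — the displayed (N) on the host's corner products: `Hyp.PeriodN`
  (T6N, the Tier-4/5 statement of (N) verbatim) of the transfer shadow `shadowOf … Bd … C … S hS f …` for every Betti
  datum `Bd` satisfying the clauses, every corner product `C` and SOME surface datum `(S, hS, f)` (TIER4 §D: `S = X_K`,
  `f = (f_i)`; TIER5 (N0.2) (q3) «(N) for SOME admissible choice», (q5) «ONE S = S_ν suffices»). It is quantified over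
  every admissible `Bd` rather than stated at a chosen one (no `Classical.choose` in a statement of record); the N
  side discharges it at M2 uniformly in `Bd`.
`hccm_of_published_M1` is the closed theorem; `HCCMOfPublished₁` is its `Prop` in the M0 form of record, inhabited
by `hccmOfPublished₁_holds`; `hccm_of_published_of_M1` shows the M0 `Prop` `HCCMOfPublished` itself follows from the
M1 binders. Every binder of `hccm_of_published_M1` is a `Hyp.*` display (ten: the nine above and `Hyp.PeriodNHost`);
no residual. No `sorry`; standard axioms (`#print axioms` = propext, Classical.choice, Quot.sound).
§8(d): uses an L-value-free non-vanishing device: NO.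
-/

noncomputable section

open CategoryTheory
open HostAPI.Carriers.AlgebraicGeometry.Motives HostAPI.Carriers.AlgebraicGeometry.HodgeTheory

namespace Summit.Ventures.HodgeRepro2.T6

open Summit.Ventures.HodgeRepro2.T6.Host Summit.Ventures.HodgeRepro2.T6.WeilInst
  Summit.Ventures.HodgeRepro2.T6.WeilAssembly Summit.Ventures.HodgeRepro2.T6.A1HostBridge
  Summit.Ventures.HodgeRepro2.T6.HostCoeff

/-- THE COEFFICIENT MAP OF RECORD: the change of coefficients `ℂ ⊗[ℚ] H^k(X(ℂ), ℚ) → H^k(X(ℂ), ℂ)` of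
T6HostCoeff at the complex points of `X`, in the shape t6-p2's `coeffNatural` proves natural. -/
abbrev coeffC₀ : ∀ (X : SchemeOver ℂ) (k : ℕ), HC X k →ₗ[ℂ] H X k :=
  fun X k => coeffC (ComplexPoints X) k

namespace Hyp

/-- [display: TIER4 A3 Theorem A (TIER4.md l. 461) hypothesis (N) — «there is σ ∈ Σ with ∫_S f_1^*e_{1,σ} ∧ f_2^*e_{2,σ} ∧
f_3^*e_{3,σ} ∧ f_4^*e_{4,σ} ≠ 0» — on the host's corner products, with the surface datum of TIER4 §D (D1–D5: `S = X_K`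
the Picard modular surface, `f = (f_i)` the correspondence) existential as TIER5 §N0 (N0.2) ll. 62–63 states it:
«there exist σ ∈ Σ and an admissible choice … such that …» ((q3) «(N) for SOME admissible choice», (q5) «ONE S = S_ν
suffices»)]
**THE (N) BINDER ON THE HOST** (README §10.4 M1, «a single displayed hypothesis (N)»): for every Betti datum `Bd`
satisfying the clauses of `Hyp.BettiHodge coeffC₀`, every Galois CM field `K` and every corner product `C` over `K`,
there is a surface datum `(S, hS, f)` (`S` a smooth projective surface over `ℂ`, `f : S → B` into the corner product's
abelian variety) whose transfer shadow `shadowOf …` (T6A2WeilAssembly, built from the displays) satisfies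
`Hyp.PeriodN` (T6N — the Tier-4/5 statement of (N), verbatim). -/
def PeriodNHost (h17 : Hyp.LangeBirkenhake1992_Lemma1_1_17)
    (hD : ∀ Bd, Hyp.LangeBirkenhake1992_Prop1_1_20 Bd) (hLefD : ∀ Bd, Hyp.Lefschetz11_Betti Bd)
    (hT21 : ∀ Bd, Hyp.LangeBirkenhake1992_Thm1_1_21_Betti Bd)
    (hProd : Hyp.Hartshorne1977_productProjective) (hPt : Hyp.Hartshorne1977_pointProjective) : Prop :=
  ∀ (Bd : BettiHodgeData ℂ) (hB : BettiClauses coeffC₀ Bd)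
    (K : Type) [Field K] [NumberField K] [IsGalois ℚ K] [NumberField.IsCMField K] (C : CornerProduct K),
    ∃ (S : SPVar ℂ) (hS : S.n = 2) (f : S.X ⟶ C.B.X),
      Hyp.PeriodN (shadowOf coeffC₀ Bd coeffNatural hB C (lemma1117Q_of_display h17) (hD Bd) (hLefD Bd) (hT21 Bd)
        S hS f hProd hPt)

end Hyp

/-- **THE M1 (host) BODY**: `HostAPI.HCCM.Statement` — the host's statement of the Hodge conjecture for complex
abelian varieties of CM type, literally — from the displayed hypotheses consumed by name and the one (N) binder.
The proof is the (S4) carrier applied to the host composite on every corner product: the Betti datum of `hBd`,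
the surface datum of `hN`, and t6-p2's `splitWeilAlgebraic_of_A2`. -/
theorem hccm_of_published_M1 (h0 : Hyp.HodgeModelExists) (hS4 : Hyp.Given_S4)
    (hBd : Hyp.BettiHodge coeffC₀) (h17 : Hyp.LangeBirkenhake1992_Lemma1_1_17)
    (hD : ∀ Bd, Hyp.LangeBirkenhake1992_Prop1_1_20 Bd) (hLefD : ∀ Bd, Hyp.Lefschetz11_Betti Bd)
    (hT21 : ∀ Bd, Hyp.LangeBirkenhake1992_Thm1_1_21_Betti Bd)
    (hProd : Hyp.Hartshorne1977_productProjective) (hPt : Hyp.Hartshorne1977_pointProjective)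
    (hN : Hyp.PeriodNHost h17 hD hLefD hT21 hProd hPt) : HostAPI.HCCM.Statement :=
  hS4 h0 (fun K _ _ _ _ C =>
    let ⟨Bd, hB⟩ := hBd
    let ⟨S, hS, f, hN'⟩ := hN Bd hB K C
    splitWeilAlgebraic_of_A2 coeffC₀ Bd coeffNatural hB C (lemma1117Q_of_display h17) (hD Bd) (hLefD Bd) (hT21 Bd)
      S hS f hProd hPt hN')

/-- THE M1 STATEMENT as a `Prop` in the M0 form of record (`HCCMOfPublished` with the M1 binders): the host's
statement from the displays and (N). -/
def HCCMOfPublished₁ : Prop :=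
  ∀ (h0 : Hyp.HodgeModelExists) (hS4 : Hyp.Given_S4) (hBd : Hyp.BettiHodge coeffC₀)
    (h17 : Hyp.LangeBirkenhake1992_Lemma1_1_17) (hD : ∀ Bd, Hyp.LangeBirkenhake1992_Prop1_1_20 Bd)
    (hLefD : ∀ Bd, Hyp.Lefschetz11_Betti Bd) (hT21 : ∀ Bd, Hyp.LangeBirkenhake1992_Thm1_1_21_Betti Bd)
    (hProd : Hyp.Hartshorne1977_productProjective) (hPt : Hyp.Hartshorne1977_pointProjective),
    Hyp.PeriodNHost h17 hD hLefD hT21 hProd hPt → HostAPI.HCCM.Statement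

/-- the M1 `Prop` is inhabited by the body -/
theorem hccmOfPublished₁_holds : HCCMOfPublished₁ :=
  fun h0 hS4 hBd h17 hD hLefD hT21 hProd hPt hN => hccm_of_published_M1 h0 hS4 hBd h17 hD hLefD hT21 hProd hPt hN

/-- THE M0 FORM FROM THE M1 BINDERS: T6Main's `HCCMOfPublished` (`HodgeModelExists → Given_S4 → Statement`) holds
given the remaining displays and (N) — the M0 `Prop` of record is reached, not restated. -/
theorem hccm_of_published_of_M1 (hBd : Hyp.BettiHodge coeffC₀) (h17 : Hyp.LangeBirkenhake1992_Lemma1_1_17)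
    (hD : ∀ Bd, Hyp.LangeBirkenhake1992_Prop1_1_20 Bd) (hLefD : ∀ Bd, Hyp.Lefschetz11_Betti Bd)
    (hT21 : ∀ Bd, Hyp.LangeBirkenhake1992_Thm1_1_21_Betti Bd)
    (hProd : Hyp.Hartshorne1977_productProjective) (hPt : Hyp.Hartshorne1977_pointProjective)
    (hN : Hyp.PeriodNHost h17 hD hLefD hT21 hProd hPt) : HCCMOfPublished :=
  fun h0 hS4 => hccm_of_published_M1 h0 hS4 hBd h17 hD hLefD hT21 hProd hPt hN

end Summit.Ventures.HodgeRepro2.T6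

end
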